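import Literature.NumberTheory.EllipticCurves.Kato2004.IwasawaCohomologyNumberFieldCMOrder
import HarnessLib

set_option linter.dupNamespace false
set_option autoImplicit false

/-!
# (ℓ1) + (ℓ2) kernels for the (C4a) skeleton: `{1, ϖ}` is `Λ`-free in `Λ_m = Λ[ϖ]/(ϖ² − m)`, and a `Λ`-torsion-free
# `Λ_m`-module is `Λ_m`-TORSION-FREE as soon as the norm form `a² − m·b²` is anisotropic — which it is for
# `(Λ, m) = (ℤ_p⟦X⟧, −p)`, in particular for the frame's `Λ_O = Λ[ϖ]/(ϖ² + 7)` (ideator bsd-idea-20 g73; crux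
# `EllipticUnitValueSevenOfGZK` = stmt-BirchSwinnertonDyer-19945)

Cell bsd-cm context (card `Lines/kato-perrin-riou-zp.md` v47 §0 (C); scope memo `bsd-cm-prr-ty1/g33/CarrierColumn-scope.md`
(c1ed60c7a00cd5c2) row (C4a); my g72 workfile `Cruxes/EllipticUnitValueSevenOfGZK/C4aValuesPin_g72.lean` (546b68cb57d992d0);
critic verdict V#22db (idea-crit-15 g16, I20 INBOX l.139)).  The g72 skeleton `C4aValuesPin.eq_smul_of_rel_of_values` pins
`x = C • y` in an `R`-module `A` from ONE non-trivial relation plus character values, under two ROUTINE side hypotheses the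
critic labelled (ℓ1) `hbasis : a + b·ϖ = 0 ⇒ a = b = 0` and (ℓ2) `htf : ∀ s m, s ≠ 0 → s • m = 0 → m = 0` («honest budget
≈ 40–80 l.»), at `R = Kato2004.QuadOrder (IwasawaAlgebra 7) (-7)` and `A = IK.ratH = 𝐇¹_{K,Γ}(T₇W_K)[1/7]` with the
`Λ_O`-structure `IK.cmModuleRat` of the Literature file (A) `Kato2004/IwasawaCohomologyNumberFieldCMOrder.lean` (p777087)
— the carriers now SERVED by `bsd-cm-prr-ty1` g34's (C1) `Additive/RamifiedSevenGenusCarrierAlgebra.lean`, whose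
`torsionFree_π` is only the `ϖ`-TORSION half.  THIS FILE discharges (ℓ1) and (ℓ2) as kernel-checked theorems over (A)'s own
declarations (`Kato2004.QuadOrder`, `QuadOrder.ϖ`, `IwasawaH1DataOver.cmModule`, `.cmModuleRat`, `.ratH`), importing (A) +
HarnessLib only:

* §1 the ARITHMETIC INPUT — `a² + p·b² = 0 ⇒ a = b = 0` in `ℤ_p` (a `p`-descent: `p ∣ a`, then `(b, a/p)` solves the same
  equation, so `p^n ∣ a` for all `n`, and `a = u·p^{v(a)}` forbids `p^{v(a)+1} ∣ a`) and in `Λ = ℤ_p⟦X⟧` (an `X`-descent on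
  top: constant coefficients vanish by the `ℤ_p` case, then `a = X a'`, `b = X b'` solve it again), for EVERY prime `p`;
* §2 the ORDER — (ℓ1) `algebraMap a + algebraMap b * ϖ = 0 ⇒ a = b = 0` (`X² − m` is monic of degree 2 and cannot divide
  `bX + a ≠ 0`; the critic's probe route, re-proved here), every `ρ ∈ Λ_m` is `a + b·ϖ`, the conjugate identity
  `(a − bϖ)(a + bϖ) = a² − m b²`, and (ℓ2-abstract) `smul_torsionFree_of_anisotropic`: for ANY `Λ_m`-module `M` through a
  scalar tower, `Λ`-torsion-free + anisotropic norm form ⇒ `ρ ≠ 0, ρ • x = 0 ⇒ x = 0` (multiply by the conjugate);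
* §3 LOCALISATION — `Λ`-torsion-freeness passes from `M` to `M[1/S]` when `M` has no `S`-torsion;
* §4 the CARRIERS — for any `IK : IwasawaH1DataOver V p κ γ`, CM-type `φ` with `φ ∘ φ = [m]`, the `Λ_m`-modules `IK.H`
  (`IK.cmModule`) and, for `V` elliptic, `IK.ratH` (`IK.cmModuleRat`) are `Λ_m`-torsion-free GIVEN (tf) `Λ`-torsion-freeness
  of `IK.H` and anisotropy of `a² − m b²`; UNCONDITIONAL in the anisotropy at `m = −p` (§1), and in the frame's letter
  `(p, m) = (7, −7)`: ★ `cmModuleRat_smul_torsionFree_seven`.  At the pinned frame `Φ : GenusSeven.KatoCMPinnedClass W 7 hD`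
  the remaining binder (tf) is the TREE THEOREM `PinnedKatoGenusFrame.tf_of_inputs hγ` (`RamifiedSevenGenusKSideRank.lean`
  l.293, GZK-free), so (ℓ2) holds at the frame with NO hypothesis left; this file does not import the Summits-side frame
  (farm-safety, as g72) and states the binder instead.

g74 DISPOSITION (memo `K2C10RowClosure-g74.md`; `C4aRankOne-g72.md` §5 n7): (ℓ1)/(ℓ2) serve the g72 pin `C4aValuesPin`, an
ABSTRACT SHADOW of the cell's block (R) `Additive/RamifiedSevenRationalComparisonOfInputs.lean` (p781873 + part 2), which proves
(C4a) in `Λ`-coordinates needing only `Λ`-(tf) + the frame's `torsionFree_π`, never `QuadOrder`-(tf) — so this file is OFF-ROAD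
(correct, V#22dc PASS; no port, no consumer, none needed).  Docstring-only v2; all theorems UNCHANGED.

HONEST LABEL: algebra only.  Nothing here proves (C4a), (C4b) = K2ᶜ, PR^×, hR3c, Conj. 12.10, `X12.CMRamifiedSeven` or BSD
for any curve; stmt-BirchSwinnertonDyer-19945 is OPEN (skeleton zp v16 `Lines/kato_perrin_riou_zp.lean` bb91f352028468bc,
4 stubs, untouched); no summit statement is proved by this seat.  0 `def` / 0 `structure` / 0 `instance` / 0 notation /
0 named fact / 0 sorry.

References: [cite: Kato2004Asterisque, Thm. 12.4 (2) (p. 222) («`𝐇¹(T)` is a torsion free `Λ`-module»), 15.14 (p. 264)]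
— K. Kato, *p-adic Hodge theory and values of zeta functions of modular forms*, Astérisque 295 (2004);
[cite: AtiyahMacdonald1969, Ch. 3 pp. 38–39 (modules of fractions, Prop. 3.3, proof of Prop. 3.5)];
[cite: Ash2006, 2.3.1 and §2.5 (factor theorem, evaluation on `R[X]`)]; Mathlib `PadicInt.prime_p`,
`PadicInt.unitCoeff_spec`, `PowerSeries.X_dvd_iff`, `AdjoinRoot.mk_surjective`, `Polynomial.Monic.not_dvd_of_natDegree_lt`,
`LocalizedModule.smul'_mk`, `IsLocalizedModule.mk'_eq_zero'`.  Tree: (A) p777087; (tf) `tf_of_inputs` p783797.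
-/

noncomputable section

open Literature.NumberTheory.EllipticCurves Literature.NumberTheory.EllipticCurves.Kato2004

namespace Summit.BirchSwinnertonDyer.BirchSwinnertonDyer.Cruxes.EllipticUnitValueSevenOfGZK.QuadOrderTorsionFree

/-! ## §1 The arithmetic input: `a² + p·b² = 0 ⇒ a = b = 0` in `ℤ_p` and in `Λ = ℤ_p⟦X⟧` (every prime `p`)

[n5, g73 self-disclosure / g74] This section RE-PROVES, by an independent `p`- and `X`-descent, the tree lemma
`Literature.NumberTheory.EllipticCurves.IwasawaAlgebra.eq_zero_of_sq_add_C_mul_sq_eq_zero {g₀ g₁ : IwasawaAlgebra p}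
(h : g₀ ^ 2 + PowerSeries.C (p : ℤ_[p]) * g₁ ^ 2 = 0) : g₀ = 0 ∧ g₁ = 0`
(`Literature/NumberTheory/EllipticCurves/IwasawaAlgebraCyclotomicSeparationProofs.lean` l.205, valuation-parity proof) — the norm
trick (R) `rationalComparisonShape_of_inputs` STEP 1′ uses.  `powerSeries_anisotropic` / `iwasawaAlgebra_anisotropic` below = that lemma up to
the casts `((-(p : ℤ) : ℤ) : IwasawaAlgebra p) = -PowerSeries.C (p : ℤ_[p])` (`Int.cast_neg`, `Int.cast_natCast`, `map_natCast`); theorems kept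
byte-identical (no wrapper), cite recorded. -/

section Anisotropy

variable {p : ℕ} [Fact p.Prime]

/-- One `p`-descent step in `ℤ_p`: `a² + p·b² = 0 ⇒ a = p·a₁` with `b² + p·a₁² = 0` (`p` is prime in `ℤ_p`).
[folklore] [cite: Kato2004Asterisque, 15.14 (p. 264)] -/
theorem padicInt_descent (a b : ℤ_[p]) (h : a ^ 2 + (p : ℤ_[p]) * b ^ 2 = 0) :
    ∃ a₁ : ℤ_[p], a = p * a₁ ∧ b ^ 2 + (p : ℤ_[p]) * a₁ ^ 2 = 0 := by
  have hp : Prime (p : ℤ_[p]) := PadicInt.prime_p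
  obtain ⟨a₁, rfl⟩ : (p : ℤ_[p]) ∣ a :=
    hp.dvd_of_dvd_pow (n := 2) ⟨-b ^ 2, by linear_combination h⟩
  refine ⟨a₁, rfl, (mul_eq_zero.mp ?_).resolve_left hp.ne_zero⟩
  linear_combination h

/-- `a² + p·b² = 0` in `ℤ_p` forces `p^n ∣ a` for every `n` (two descent steps per power). [folklore]
[cite: Kato2004Asterisque, 15.14 (p. 264)] -/
theorem padicInt_pow_dvd (n : ℕ) :
    ∀ a b : ℤ_[p], a ^ 2 + (p : ℤ_[p]) * b ^ 2 = 0 → (p : ℤ_[p]) ^ n ∣ a := by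
  induction n with
  | zero => exact fun a _ _ ↦ by rw [pow_zero]; exact one_dvd a
  | succ n ih =>
    intro a b h
    obtain ⟨a₁, rfl, h₁⟩ := padicInt_descent a b h
    obtain ⟨b₁, rfl, h₂⟩ := padicInt_descent b a₁ h₁
    obtain ⟨c, hc⟩ := ih a₁ b₁ h₂
    exact ⟨c, by rw [hc, pow_succ]; ring⟩

/-- In `ℤ_p` an element divisible by every power of `p` is `0` (`a = u·p^{v(a)}` with `u` a unit). [folklore]
[cite: Kato2004Asterisque, 15.14 (p. 264)] -/
theorem padicInt_eq_zero_of_forall_pow_dvd (a : ℤ_[p]) (h : ∀ n : ℕ, (p : ℤ_[p]) ^ n ∣ a) : a = 0 := by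
  by_contra ha
  have hp : Prime (p : ℤ_[p]) := PadicInt.prime_p
  obtain ⟨c, hc⟩ := h (a.valuation + 1)
  have hu : (PadicInt.unitCoeff ha : ℤ_[p]) = p * c := by
    refine mul_left_cancel₀ (pow_ne_zero a.valuation hp.ne_zero) ?_
    rw [mul_comm ((p : ℤ_[p]) ^ a.valuation) (PadicInt.unitCoeff ha : ℤ_[p]), ← PadicInt.unitCoeff_spec ha,
      ← mul_assoc, ← pow_succ, ← hc]
  exact hp.not_unit (isUnit_of_dvd_unit ⟨c, hu⟩ (PadicInt.unitCoeff ha).isUnit)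

/-- **`a² + p·b² = 0 ⇒ a = b = 0` in `ℤ_p`** (`−p` is not a square in `ℚ_p`: `v_p(−p)` is odd). [folklore]
[cite: Kato2004Asterisque, 15.14 (p. 264)] -/
theorem padicInt_anisotropic (a b : ℤ_[p]) (h : a ^ 2 + (p : ℤ_[p]) * b ^ 2 = 0) : a = 0 ∧ b = 0 := by
  have ha : a = 0 := padicInt_eq_zero_of_forall_pow_dvd a fun n ↦ padicInt_pow_dvd n a b h
  subst ha
  have hb : (p : ℤ_[p]) * b ^ 2 = 0 := by linear_combination h
  exact ⟨rfl, (pow_eq_zero_iff two_ne_zero).mp ((mul_eq_zero.mp hb).resolve_left PadicInt.prime_p.ne_zero)⟩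

/-- `a² + p·b² = 0` in `ℤ_p⟦X⟧` kills every coefficient of `a` and `b` (constant coefficients by the `ℤ_p` case, then
`a = X·a'`, `b = X·b'` solve the same equation). [folklore] [cite: Kato2004Asterisque, 15.14 (p. 264)] -/
theorem powerSeries_coeff_eq_zero (n : ℕ) : ∀ a b : PowerSeries ℤ_[p],
    a ^ 2 + (p : PowerSeries ℤ_[p]) * b ^ 2 = 0 → PowerSeries.coeff n a = 0 ∧ PowerSeries.coeff n b = 0 := by
  have h0 : ∀ a b : PowerSeries ℤ_[p], a ^ 2 + (p : PowerSeries ℤ_[p]) * b ^ 2 = 0 →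
      PowerSeries.constantCoeff a = 0 ∧ PowerSeries.constantCoeff b = 0 := fun a b h ↦ by
    refine padicInt_anisotropic _ _ ?_
    have h' := congrArg PowerSeries.constantCoeff h
    rwa [map_add, map_mul, map_pow, map_pow, map_natCast, map_zero] at h'
  induction n with
  | zero =>
    intro a b h
    simpa only [PowerSeries.coeff_zero_eq_constantCoeff_apply] using h0 a b h
  | succ n ih =>
    intro a b h
    obtain ⟨ha, hb⟩ := h0 a b h
    obtain ⟨a', rfl⟩ := PowerSeries.X_dvd_iff.mpr ha
    obtain ⟨b', rfl⟩ := PowerSeries.X_dvd_iff.mpr hb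
    have h' : a' ^ 2 + (p : PowerSeries ℤ_[p]) * b' ^ 2 = 0 := by
      refine (mul_eq_zero.mp ?_).resolve_left (pow_ne_zero 2 (PowerSeries.X_ne_zero (R := ℤ_[p])))
      linear_combination h
    obtain ⟨ha', hb'⟩ := ih a' b' h'
    exact ⟨by rw [PowerSeries.coeff_succ_X_mul, ha'], by rw [PowerSeries.coeff_succ_X_mul, hb']⟩

/-- **`a² + p·b² = 0 ⇒ a = b = 0` in `Λ = ℤ_p⟦X⟧`.** [folklore] [cite: Kato2004Asterisque, 15.14 (p. 264)] -/
theorem powerSeries_anisotropic (a b : PowerSeries ℤ_[p]) (h : a ^ 2 + (p : PowerSeries ℤ_[p]) * b ^ 2 = 0) :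
    a = 0 ∧ b = 0 :=
  ⟨PowerSeries.ext fun n ↦ by rw [(powerSeries_coeff_eq_zero n a b h).1, map_zero],
    PowerSeries.ext fun n ↦ by rw [(powerSeries_coeff_eq_zero n a b h).2, map_zero]⟩

/-- The norm form `a² − m·b²` of `Λ_m` at `(Λ, m) = (IwasawaAlgebra p, −p)` is ANISOTROPIC. [folklore]
[cite: Kato2004Asterisque, 15.14 (p. 264)] -/
theorem iwasawaAlgebra_anisotropic (a b : IwasawaAlgebra p)
    (h : a ^ 2 - ((-(p : ℤ) : ℤ) : IwasawaAlgebra p) * b ^ 2 = 0) : a = 0 ∧ b = 0 := by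
  refine powerSeries_anisotropic a b ?_
  rw [Int.cast_neg, Int.cast_natCast] at h
  linear_combination h

/-- The norm form at the frame's letter `(Λ, m) = (IwasawaAlgebra 7, −7)`: `a² + 7·b² = 0 ⇒ a = b = 0` in `ℤ₇⟦X⟧`.
[folklore] [cite: Kato2004Asterisque, 15.14 (p. 264)] -/
theorem iwasawaAlgebra_seven_anisotropic [Fact (Nat.Prime 7)] (a b : IwasawaAlgebra 7)
    (h : a ^ 2 - ((-7 : ℤ) : IwasawaAlgebra 7) * b ^ 2 = 0) : a = 0 ∧ b = 0 := by
  refine powerSeries_anisotropic (p := 7) a b ?_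
  rw [Int.cast_neg, Int.cast_ofNat] at h
  rw [Nat.cast_ofNat]
  linear_combination h

end Anisotropy

/-! ## §2 The order `Λ_m = Λ[ϖ]/(ϖ² − m)`: (ℓ1) `{1, ϖ}` free, `ρ = a + b·ϖ`, conjugates, and (ℓ2-abstract) torsion -/

section Order

open Polynomial

variable {Λ : Type*} [CommRing Λ] {m : ℤ}

/-- **(ℓ1) `{1, ϖ}` is `Λ`-free in `Λ_m`**: `a + b·ϖ = 0 ⇒ a = b = 0` (`X² − m` is monic of degree `2`, so it divides no
non-zero `bX + a`) — the `hbasis` binder of `C4aValuesPin.exists_rel_two_of_rel_three` (critic V#22db's probe route).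
[folklore] [cite: Ash2006, 2.3.1 and §2.5] -/
theorem algebraMap_add_mul_ϖ_eq_zero [Nontrivial Λ] (a b : Λ)
    (h : algebraMap Λ (QuadOrder Λ m) a + algebraMap Λ (QuadOrder Λ m) b * QuadOrder.ϖ = 0) :
    a = 0 ∧ b = 0 := by
  rw [AdjoinRoot.algebraMap_eq, QuadOrder.ϖ_eq_mk_X] at h
  have hdvd : quadPoly Λ m ∣ C b * X + C a := by
    rw [← AdjoinRoot.mk_eq_zero, map_add, map_mul, AdjoinRoot.mk_C, AdjoinRoot.mk_C, ← h, add_comm]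
  have hq : C b * X + C a = 0 := by
    by_contra hne
    refine (monic_X_pow_sub_C (m : Λ) two_ne_zero).not_dvd_of_natDegree_lt hne ?_ hdvd
    rw [natDegree_X_pow_sub_C]
    exact lt_of_le_of_lt natDegree_linear_le one_lt_two
  have hb : b = 0 := by simpa using congrArg (fun q : Λ[X] ↦ q.coeff 1) hq
  have ha : a = 0 := by simpa using congrArg (fun q : Λ[X] ↦ q.coeff 0) hq
  exact ⟨ha, hb⟩

/-- Every element of `Λ_m` is `a + b·ϖ` (`X² ≡ m`). [folklore] [cite: Ash2006, 2.3.1 and §2.5] -/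
theorem exists_eq_algebraMap_add_mul_ϖ (ρ : QuadOrder Λ m) :
    ∃ a b : Λ, ρ = algebraMap Λ (QuadOrder Λ m) a + algebraMap Λ (QuadOrder Λ m) b * QuadOrder.ϖ := by
  obtain ⟨g, rfl⟩ := AdjoinRoot.mk_surjective ρ
  rw [AdjoinRoot.algebraMap_eq, QuadOrder.ϖ_eq_mk_X]
  refine Polynomial.induction_on g (fun a ↦ ⟨a, 0, by rw [map_zero, zero_mul, add_zero, AdjoinRoot.mk_C]⟩) ?_ ?_
  · rintro f g ⟨a, b, hf⟩ ⟨c, d, hg⟩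
    exact ⟨a + c, b + d, by rw [map_add, hf, hg, map_add, map_add]; ring⟩
  · rintro n a ⟨c, d, h⟩
    refine ⟨(m : Λ) * d, c, ?_⟩
    rw [pow_succ, ← mul_assoc, map_mul, h, map_mul, map_intCast, add_mul, mul_assoc, ← pow_two,
      ← QuadOrder.ϖ_eq_mk_X, QuadOrder.ϖ_sq]
    ring

/-- The conjugate identity `(a − b·ϖ)(a + b·ϖ) = a² − m·b²` in `Λ_m`. [folklore] [cite: Ash2006, 2.3.1 and §2.5] -/
theorem conj_mul_eq (a b : Λ) :
    (algebraMap Λ (QuadOrder Λ m) a - algebraMap Λ (QuadOrder Λ m) b * QuadOrder.ϖ) *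
        (algebraMap Λ (QuadOrder Λ m) a + algebraMap Λ (QuadOrder Λ m) b * QuadOrder.ϖ) =
      algebraMap Λ (QuadOrder Λ m) (a ^ 2 - (m : Λ) * b ^ 2) := by
  rw [map_sub, map_mul, map_pow, map_pow, map_intCast, ← QuadOrder.ϖ_sq]
  ring

/-- **(ℓ2-abstract) `Λ`-torsion-free + anisotropic norm ⇒ `Λ_m`-torsion-free.**  For any `Λ_m`-module `M` whose
`Λ_m`-structure restricts to its `Λ`-structure (`IsScalarTower`), if `f ≠ 0, f • x = 0 ⇒ x = 0` over `Λ` and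
`a² − m b² = 0 ⇒ a = b = 0` in `Λ`, then `ρ ≠ 0, ρ • x = 0 ⇒ x = 0` over `Λ_m`: write `ρ = a + bϖ` and multiply by
`a − bϖ`. — the `htf` binder of `C4aValuesPin.eq_smul_of_rel_of_values`. [folklore]
[cite: Kato2004Asterisque, Thm. 12.4 (2) (p. 222)] -/
theorem smul_torsionFree_of_anisotropic {M : Type*} [AddCommGroup M] [Module Λ M]
    [Module (QuadOrder Λ m) M] [IsScalarTower Λ (QuadOrder Λ m) M]
    (hΛ : ∀ (f : Λ) (x : M), f ≠ 0 → f • x = 0 → x = 0)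
    (hN : ∀ a b : Λ, a ^ 2 - (m : Λ) * b ^ 2 = 0 → a = 0 ∧ b = 0) :
    ∀ (ρ : QuadOrder Λ m) (x : M), ρ ≠ 0 → ρ • x = 0 → x = 0 := by
  intro ρ x hρ hx
  obtain ⟨a, b, rfl⟩ := exists_eq_algebraMap_add_mul_ϖ ρ
  have hn : a ^ 2 - (m : Λ) * b ^ 2 ≠ 0 := by
    intro h0
    obtain ⟨rfl, rfl⟩ := hN a b h0
    exact hρ (by rw [map_zero, zero_mul, add_zero])
  refine hΛ _ x hn ?_
  rw [← algebraMap_smul (QuadOrder Λ m), ← conj_mul_eq, mul_smul, hx, smul_zero]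

end Order

/-! ## §3 Localisation: `Λ`-torsion-freeness passes to `M[1/S]` when `M` has no `S`-torsion -/

section Localized

variable {Λ : Type*} [CommRing Λ] {M : Type*} [AddCommGroup M] [Module Λ M] (S : Submonoid Λ)

/-- **`M` `Λ`-torsion-free and `S`-torsion-free ⇒ `M[1/S]` `Λ`-torsion-free**: `f • (x/s) = 0` means `u·f·x = 0` for
some `u ∈ S`. [folklore] [cite: AtiyahMacdonald1969, Ch. 3 pp. 38–39 (Prop. 3.3; proof of Prop. 3.5: «m/s = 0, hence
tm = 0 for some t ∈ S»)] -/
theorem localizedModule_smul_torsionFree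
    (hS : ∀ (s : S) (x : M), (s : Λ) • x = 0 → x = 0)
    (hM : ∀ (f : Λ) (x : M), f ≠ 0 → f • x = 0 → x = 0) :
    ∀ (f : Λ) (y : LocalizedModule S M), f ≠ 0 → f • y = 0 → y = 0 := by
  intro f y hf hy
  induction y using LocalizedModule.induction_on with
  | h x s =>
    rw [LocalizedModule.smul'_mk, IsLocalizedModule.mk_eq_mk', IsLocalizedModule.mk'_eq_zero'] at hy
    obtain ⟨u, hu⟩ := hy
    rw [hM f x hf (hS u (f • x) (by rwa [Submonoid.smul_def] at hu)), LocalizedModule.zero_mk]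

end Localized

/-! ## §4 The carriers: `𝐇¹_{K,Γ}(T_pV)` and `𝐇¹[1/p]` are `Λ_m`-torsion-free (given (tf); anisotropy free at `m = −p`) -/

section CM

variable {K : Type} [Field K] {V : WeierstrassCurve K} {p : ℕ} [Fact p.Prime] [ContinuousSMul ℤ_[p] (V.tateModule p)]
  {κ : ZpExtension K p} {γ : Field.absoluteGaloisGroup K}

/-- **`𝐇¹_{K,Γ}(T_pV)` is `Λ_m`-torsion-free** for the structure `IK.cmModule` (`ϖ ↦ φ_*`, `φ ∘ φ = [m]`), GIVEN (tf)
`Λ`-torsion-freeness of `IK.H` and anisotropy of `a² − m b²` over `Λ`. [cite: Kato2004Asterisque, Thm. 12.4 (2) (p. 222)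
and 15.14 (p. 264)] -/
theorem cmModule_smul_torsionFree (IK : IwasawaH1DataOver V p κ γ) (hγ : κ.IsTopGenerator γ)
    (φ : WeierstrassCurve.Isogeny V V) {m : ℤ} (hφ : ∀ P, φ (φ P) = m • P)
    (hN : ∀ a b : IwasawaAlgebra p, a ^ 2 - (m : IwasawaAlgebra p) * b ^ 2 = 0 → a = 0 ∧ b = 0)
    (htf : ∀ (f : IwasawaAlgebra p) (x : IK.H), f ≠ 0 → f • x = 0 → x = 0) :
    letI := IK.cmModule hγ φ hφ
    ∀ (ρ : QuadOrder (IwasawaAlgebra p) m) (x : IK.H), ρ ≠ 0 → ρ • x = 0 → x = 0 := by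
  letI := IK.cmModule hγ φ hφ
  haveI := QuadOrder.isScalarTower_moduleOfOperator (IK.isogenyMap φ IK hγ)
    (IK.isogenyMap_sq_of_comp_self_eq_zsmul hγ φ hφ)
  exact smul_torsionFree_of_anisotropic htf hN

variable [V.IsElliptic]

/-- **`𝐇¹_{K,Γ}(T_pV)[1/p]` is `Λ_m`-torsion-free** for the structure `IK.cmModuleRat` (the frame's `instModule` on
`A = IK.ratH`), GIVEN (tf) `Λ`-torsion-freeness of `IK.H` and anisotropy of `a² − m b²` over `Λ` (no `p`-torsion in
`IK.H` is the tree's `IK.eq_zero_of_powers_smul_eq_zero`). [cite: Kato2004Asterisque, Thm. 12.4 (2) (p. 222) and 15.14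
(p. 264)] -/
theorem cmModuleRat_smul_torsionFree (IK : IwasawaH1DataOver V p κ γ) (hγ : κ.IsTopGenerator γ)
    (φ : WeierstrassCurve.Isogeny V V) {m : ℤ} (hφ : ∀ P, φ (φ P) = m • P)
    (hN : ∀ a b : IwasawaAlgebra p, a ^ 2 - (m : IwasawaAlgebra p) * b ^ 2 = 0 → a = 0 ∧ b = 0)
    (htf : ∀ (f : IwasawaAlgebra p) (x : IK.H), f ≠ 0 → f • x = 0 → x = 0) :
    letI := IK.cmModuleRat hγ φ hφ
    ∀ (ρ : QuadOrder (IwasawaAlgebra p) m) (y : IK.ratH), ρ ≠ 0 → ρ • y = 0 → y = 0 := by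
  letI := IK.cmModuleRat hγ φ hφ
  haveI := IK.isScalarTower_cmModuleRat hγ φ hφ
  exact smul_torsionFree_of_anisotropic
    (localizedModule_smul_torsionFree _ IK.eq_zero_of_powers_smul_eq_zero htf) hN

/-- **(ℓ2) at `m = −p`, unconditional in the anisotropy**: `𝐇¹[1/p]` is `Λ[ϖ]/(ϖ² + p)`-torsion-free given (tf).
[cite: Kato2004Asterisque, Thm. 12.4 (2) (p. 222) and 15.14 (p. 264)] -/
theorem cmModuleRat_smul_torsionFree_neg (IK : IwasawaH1DataOver V p κ γ) (hγ : κ.IsTopGenerator γ)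
    (φ : WeierstrassCurve.Isogeny V V) (hφ : ∀ P, φ (φ P) = (-(p : ℤ)) • P)
    (htf : ∀ (f : IwasawaAlgebra p) (x : IK.H), f ≠ 0 → f • x = 0 → x = 0) :
    letI := IK.cmModuleRat hγ φ hφ
    ∀ (ρ : QuadOrder (IwasawaAlgebra p) (-(p : ℤ))) (y : IK.ratH), ρ ≠ 0 → ρ • y = 0 → y = 0 :=
  cmModuleRat_smul_torsionFree IK hγ φ hφ iwasawaAlgebra_anisotropic htf

end CM

section Seven

variable {K : Type} [Field K] {V : WeierstrassCurve K} [Fact (Nat.Prime 7)] [ContinuousSMul ℤ_[7] (V.tateModule 7)]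
  {κ : ZpExtension K 7} {γ : Field.absoluteGaloisGroup K} [V.IsElliptic]

/-- ★ **(ℓ2) in the frame's letter `(p, m) = (7, −7)`**: for the `K`-side pin `IK` of a curve `V/K` elliptic with a
`K`-isogeny `φ`, `φ ∘ φ = [−7]` (the frame: `V = W_{ℚ(√−7)}`, `φ = √−7`), the carrier `A = IK.ratH = 𝐇¹_{K,Γ}(T₇V)[1/7]`
with `instModule = IK.cmModuleRat hγ φ hφ` is TORSION-FREE over `R = Λ_O = QuadOrder (IwasawaAlgebra 7) (-7)`, GIVEN
(tf) — at the pinned frame (tf) is `GenusSeven.PinnedKatoGenusFrame.tf_of_inputs hγ` (tree theorem: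
`Summits/BirchSwinnertonDyer/Rank1Residual/Additive/RamifiedSevenGenusKSideRank.lean` l.293, p783797, GZK-free [n3, g74]), so the `htf` binder of the
(C4a) skeleton `C4aValuesPin.eq_smul_of_rel_of_values` is discharged there. [cite: Kato2004Asterisque, Thm. 12.4 (2)
(p. 222) and 15.14 (p. 264)] -/
theorem cmModuleRat_smul_torsionFree_seven (IK : IwasawaH1DataOver V 7 κ γ) (hγ : κ.IsTopGenerator γ)
    (φ : WeierstrassCurve.Isogeny V V) (hφ : ∀ P, φ (φ P) = (-7 : ℤ) • P)
    (htf : ∀ (f : IwasawaAlgebra 7) (x : IK.H), f ≠ 0 → f • x = 0 → x = 0) :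
    letI := IK.cmModuleRat hγ φ hφ
    ∀ (ρ : QuadOrder (IwasawaAlgebra 7) (-7)) (y : IK.ratH), ρ ≠ 0 → ρ • y = 0 → y = 0 :=
  cmModuleRat_smul_torsionFree IK hγ φ hφ iwasawaAlgebra_seven_anisotropic htf

omit [V.IsElliptic] in
/-- (ℓ2) for the integral carrier `IK.H` itself in the frame's letter (structure `IK.cmModule`), GIVEN (tf).
[cite: Kato2004Asterisque, Thm. 12.4 (2) (p. 222) and 15.14 (p. 264)] -/
theorem cmModule_smul_torsionFree_seven (IK : IwasawaH1DataOver V 7 κ γ) (hγ : κ.IsTopGenerator γ)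
    (φ : WeierstrassCurve.Isogeny V V) (hφ : ∀ P, φ (φ P) = (-7 : ℤ) • P)
    (htf : ∀ (f : IwasawaAlgebra 7) (x : IK.H), f ≠ 0 → f • x = 0 → x = 0) :
    letI := IK.cmModule hγ φ hφ
    ∀ (ρ : QuadOrder (IwasawaAlgebra 7) (-7)) (x : IK.H), ρ ≠ 0 → ρ • x = 0 → x = 0 :=
  cmModule_smul_torsionFree IK hγ φ hφ iwasawaAlgebra_seven_anisotropic htf

end Seven

/-! ## Sanity: the arithmetic input computes on closed terms -/

/-- `a² + 7·b² = 0 ⇒ a = b = 0` in `ℤ₇⟦X⟧`, the form the memo quotes. -/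
example [Fact (Nat.Prime 7)] (a b : IwasawaAlgebra 7) (h : a ^ 2 + 7 * b ^ 2 = 0) : a = 0 ∧ b = 0 :=
  iwasawaAlgebra_seven_anisotropic a b (by rw [Int.cast_neg, Int.cast_ofNat]; linear_combination h)

end Summit.BirchSwinnertonDyer.BirchSwinnertonDyer.Cruxes.EllipticUnitValueSevenOfGZK.QuadOrderTorsionFree

end
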